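import Summits.CriticalPhenomena.PercolationContinuityZ3.Theorems.PercNearOneGluingNoHeavyLowerTailTwoPortExchangeMasses
import Summits.CriticalPhenomena.PercolationContinuityZ3.Theorems.PercNearOneGluingNoHeavyLowerTailThreeRelaySliding
import HarnessLib

/-!
# `NoHeavyLowerTail` (stmt-CriticalPhenomena-4575) — the restricted-attachment exchange REX(2) for a TWO-PORT OBSERVER

Support file (lemma factory #8 `prim-lf-8`, gen 9; `--supports stmt-CriticalPhenomena-4575`).  No definitions, no named facts,
no sorries.  `μ = prodBernoulli w` on `Fin n`, relays `A`, level `j`, `π(v) = {r ∈ A : v ↔ r}`, `L_v = {|π(v)| ≤ j}`, `H_v = {|π(v)| > j}`.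

**Theorem (`twoPort_rex`).**  Let `o ∉ A` be a vertex whose only pairs of positive weight are `s(o,a)` and `s(o,b)`
(`a ≠ b`, `a, b, q ≠ o`; "two-port observer"), and let `q` beat `a` and `b` at level `j` (`S(a) ≤ S(q)`, `S(b) ≤ S(q)`,
`S(v) = μ(L_v)`).  Then
  `μ(({o↔a} ∪ {o↔b}) ∩ L_o ∩ H_q) ≤ μ(({o↔a} ∪ {o↔b}) ∩ H_o ∩ L_q)`,
i.e. the restricted-attachment exchange REX(`Q = {a,b}`; `q`) (prim-lf-8 CANDIDATES B8-6; typed reduction to the crux in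
`…RestrictedAttachmentExchange.lean`) holds for every observer adjacent to at most the two relays of `Q` — the first case of
REX beyond `|Q| = 1` (the "boundary `{b, b'}` of two non-champion relays" left open in `…AttachedChampionTwoGate.lean`, in its
direct-adjacency form).
Proof.  Conditioning on the two pairs at `o` (`stub_oneBondDecomp_k15`, `tieLiftOne_real_one_eq`) writes every quantity as a
combination of probabilities under `w₀` = `w` with the pairs at `o` switched off; with `α = w(o,a)`, `β = w(o,b)`,
`cc'_x = μ₀(L_x ∩ H_q)`, `CC'_x = μ₀(H_x ∩ L_q)`, `g = μ₀({q↮a,b} ∩ L_{ab} ∩ H_q)`, `G = μ₀({q↮a,b} ∩ H_{ab} ∩ L_q)`: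
`LHS = α(1−β) cc'_a + (1−α)β cc'_b + αβ g`, `RHS = α(1−β) CC'_a + (1−α)β CC'_b + αβ G`, and championship reads
`(1−αβ) cc'_x + αβ g ≤ (1−αβ) CC'_x + αβ G`.  The glued-pair bound `g · CC'_x ≤ G · cc'_x` (`ThreeRelaySliding.gluedPair_exchange_le`)
forces `g ≤ G`, and then `LHS − RHS ≤ −αβ (G − g)(1−α)(1−β)/(1−αβ) ≤ 0`.
-/

noncomputable section

namespace Summit.CriticalPhenomena.PercolationContinuityZ3.Theorems

open MeasureTheory Set Literature.Probability.LatticeModels Literature.Probability.Percolation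
open scoped Classical BigOperators

variable {n : ℕ}

namespace TwoPortExchange

/-! ### The two-port restricted-attachment exchange -/

/-- **REX(2) for a two-port observer.**  If the non-relay `o` has positive-weight pairs only to `a` and `b` (`a ≠ b`,
`a, b, q ≠ o`), and `q` beats `a` and `b` at level `j` (`S(a) ≤ S(q)`, `S(b) ≤ S(q)`), then
`μ(({o↔a} ∪ {o↔b}) ∩ L_o ∩ H_q) ≤ μ(({o↔a} ∪ {o↔b}) ∩ H_o ∩ L_q)`. [this work] -/
theorem twoPort_rex (w : Sym2 (Fin n) → unitInterval) (A : Finset (Fin n)) (o a b q : Fin n) (j : ℕ)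
    (ho : o ∉ A) (hao : a ≠ o) (hbo : b ≠ o) (hqo : q ≠ o) (hab : a ≠ b)
    (hport : ∀ v, v ≠ o → v ≠ a → v ≠ b → w s(o, v) = 0)
    (hSa : (prodBernoulli w).real {ω : BondConfig (Fin n) | (A.filter fun r => ω ∈ openConn a r).card ≤ j} ≤
      (prodBernoulli w).real {ω : BondConfig (Fin n) | (A.filter fun r => ω ∈ openConn q r).card ≤ j})
    (hSb : (prodBernoulli w).real {ω : BondConfig (Fin n) | (A.filter fun r => ω ∈ openConn b r).card ≤ j} ≤
      (prodBernoulli w).real {ω : BondConfig (Fin n) | (A.filter fun r => ω ∈ openConn q r).card ≤ j}) :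
    (prodBernoulli w).real ((((openConn o a : Set (BondConfig (Fin n))) ∪ (openConn o b : Set (BondConfig (Fin n)))) ∩
        {ω | (A.filter fun r => ω ∈ openConn o r).card ≤ j}) ∩ {ω | j < (A.filter fun r => ω ∈ openConn q r).card}) ≤
      (prodBernoulli w).real ((((openConn o a : Set (BondConfig (Fin n))) ∪ (openConn o b : Set (BondConfig (Fin n)))) ∩
        {ω | j < (A.filter fun r => ω ∈ openConn o r).card}) ∩ {ω | (A.filter fun r => ω ∈ openConn q r).card ≤ j}) := by
  have hmeas : ∀ s : Set (BondConfig (Fin n)), MeasurableSet s := fun _ => MeasurableSet.of_discrete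
  -- the two pairs at `o` and the switched-off weights
  have heab : s(o, a) ≠ s(o, b) := by
    intro h
    rcases Sym2.eq_iff.1 h with ⟨-, h2⟩ | ⟨h1, -⟩
    · exact hab h2
    · exact hbo h1.symm
  set w₀ := Function.update (Function.update w s(o, a) 0) s(o, b) 0 with hw₀def
  have hw₀ : ∀ v, v ≠ o → w₀ s(o, v) = 0 := by
    intro v hv
    by_cases hvb : v = b
    · subst hvb; rw [hw₀def, Function.update_self]
    by_cases hva : v = a
    · subst hva
      rw [hw₀def, Function.update_of_ne heab, Function.update_self]
    have h1 : s(o, v) ≠ s(o, b) := by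
      intro h; rcases Sym2.eq_iff.1 h with ⟨-, h2⟩ | ⟨h2, -⟩
      · exact hvb h2
      · exact hbo h2.symm
    have h2 : s(o, v) ≠ s(o, a) := by
      intro h; rcases Sym2.eq_iff.1 h with ⟨-, h2⟩ | ⟨h2, -⟩
      · exact hva h2
      · exact hao h2.symm
    rw [hw₀def, Function.update_of_ne h1, Function.update_of_ne h2]
    exact hport v hv hva hvb
  -- the glued-pair filters after opening both pairs
  have fABo : ∀ ω : BondConfig (Fin n), (∀ v, v ≠ o → s(o, v) ∉ ω) →
      (A.filter fun r => insert s(o, a) (insert s(o, b) ω) ∈ openConn o r) =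
        A.filter fun r => ω ∈ openConn a r ∨ ω ∈ openConn b r :=
    fun ω hω => filter_insert_two_o A hω ho hao hbo
  have fABa : ∀ ω : BondConfig (Fin n), (∀ v, v ≠ o → s(o, v) ∉ ω) →
      (A.filter fun r => insert s(o, a) (insert s(o, b) ω) ∈ openConn a r) =
        A.filter fun r => ω ∈ openConn a r ∨ ω ∈ openConn b r :=
    fun ω hω => filter_insert_two_of_reach A hω ho hao hbo hao (Or.inl (SimpleGraph.Reachable.refl a))
  have fABb : ∀ ω : BondConfig (Fin n), (∀ v, v ≠ o → s(o, v) ∉ ω) →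
      (A.filter fun r => insert s(o, a) (insert s(o, b) ω) ∈ openConn b r) =
        A.filter fun r => ω ∈ openConn a r ∨ ω ∈ openConn b r :=
    fun ω hω => filter_insert_two_of_reach A hω ho hao hbo hbo (Or.inr (SimpleGraph.Reachable.refl b))
  have hUo : ∀ ω : BondConfig (Fin n), (∀ v, v ≠ o → s(o, v) ∉ ω) →
      insert s(o, a) (insert s(o, b) ω) ∈ (openConn o a : Set (BondConfig (Fin n))) ∪ (openConn o b : Set (BondConfig (Fin n))) :=
    fun ω hω => Or.inl ((reachable_insert_two_o_iff hω hao hbo hao).2 (Or.inl (SimpleGraph.Reachable.refl a)))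
  have hUuniv : ∀ ω : BondConfig (Fin n), (∀ v, v ≠ o → s(o, v) ∉ ω) →
      insert s(o, a) (insert s(o, b) ω) ∈ (univ : Set (BondConfig (Fin n))) := fun _ _ => mem_univ _
  -- the decomposition of the four attached masses
  have dX := real_twoPair_decomp w o a b heab
    ((((openConn o a : Set (BondConfig (Fin n))) ∪ (openConn o b : Set (BondConfig (Fin n)))) ∩
        {ω | (A.filter fun r => ω ∈ openConn o r).card ≤ j}) ∩ {ω | j < (A.filter fun r => ω ∈ openConn q r).card})
  have dY := real_twoPair_decomp w o a b heab
    ((((openConn o a : Set (BondConfig (Fin n))) ∪ (openConn o b : Set (BondConfig (Fin n)))) ∩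
        {ω | j < (A.filter fun r => ω ∈ openConn o r).card}) ∩ {ω | (A.filter fun r => ω ∈ openConn q r).card ≤ j})
  have x0 := real_attached_eq_zero w₀ hw₀ hao hbo
    ({ω | (A.filter fun r => ω ∈ openConn o r).card ≤ j} ∩ {ω | j < (A.filter fun r => ω ∈ openConn q r).card})
  have y0 := real_attached_eq_zero w₀ hw₀ hao hbo
    ({ω | j < (A.filter fun r => ω ∈ openConn o r).card} ∩ {ω | (A.filter fun r => ω ∈ openConn q r).card ≤ j})
  rw [inter_assoc, x0] at dX
  rw [inter_assoc, y0] at dY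
  rw [← inter_assoc] at dX dY
  have xa : (prodBernoulli w₀).real ((fun ω : BondConfig (Fin n) => insert s(o, a) ω) ⁻¹'
      ((((openConn o a : Set (BondConfig (Fin n))) ∪ (openConn o b : Set (BondConfig (Fin n)))) ∩
        {ω | (A.filter fun r => ω ∈ openConn o r).card ≤ j}) ∩ {ω | j < (A.filter fun r => ω ∈ openConn q r).card})) =
      (prodBernoulli w₀).real ({ω | (A.filter fun r => ω ∈ openConn a r).card ≤ j} ∩
        {ω | j < (A.filter fun r => ω ∈ openConn q r).card}) :=
    real_preimage_one_attached w₀ A hw₀ ho hao hqo (fun c => c ≤ j) (fun c => j < c)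
  have xb : (prodBernoulli w₀).real ((fun ω : BondConfig (Fin n) => insert s(o, b) ω) ⁻¹'
      ((((openConn o a : Set (BondConfig (Fin n))) ∪ (openConn o b : Set (BondConfig (Fin n)))) ∩
        {ω | (A.filter fun r => ω ∈ openConn o r).card ≤ j}) ∩ {ω | j < (A.filter fun r => ω ∈ openConn q r).card})) =
      (prodBernoulli w₀).real ({ω | (A.filter fun r => ω ∈ openConn b r).card ≤ j} ∩
        {ω | j < (A.filter fun r => ω ∈ openConn q r).card}) := by
    rw [union_comm]
    exact real_preimage_one_attached w₀ A hw₀ ho hbo hqo (fun c => c ≤ j) (fun c => j < c)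
  have xab := real_preimage_two_light w₀ A j hw₀ ho hao hbo hqo fABo _ hUo
  have ya : (prodBernoulli w₀).real ((fun ω : BondConfig (Fin n) => insert s(o, a) ω) ⁻¹'
      ((((openConn o a : Set (BondConfig (Fin n))) ∪ (openConn o b : Set (BondConfig (Fin n)))) ∩
        {ω | j < (A.filter fun r => ω ∈ openConn o r).card}) ∩ {ω | (A.filter fun r => ω ∈ openConn q r).card ≤ j})) =
      (prodBernoulli w₀).real ({ω | j < (A.filter fun r => ω ∈ openConn a r).card} ∩
        {ω | (A.filter fun r => ω ∈ openConn q r).card ≤ j}) :=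
    real_preimage_one_attached w₀ A hw₀ ho hao hqo (fun c => j < c) (fun c => c ≤ j)
  have yb : (prodBernoulli w₀).real ((fun ω : BondConfig (Fin n) => insert s(o, b) ω) ⁻¹'
      ((((openConn o a : Set (BondConfig (Fin n))) ∪ (openConn o b : Set (BondConfig (Fin n)))) ∩
        {ω | j < (A.filter fun r => ω ∈ openConn o r).card}) ∩ {ω | (A.filter fun r => ω ∈ openConn q r).card ≤ j})) =
      (prodBernoulli w₀).real ({ω | j < (A.filter fun r => ω ∈ openConn b r).card} ∩
        {ω | (A.filter fun r => ω ∈ openConn q r).card ≤ j}) := by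
    rw [union_comm]
    exact real_preimage_one_attached w₀ A hw₀ ho hbo hqo (fun c => j < c) (fun c => c ≤ j)
  have yab := real_preimage_two_heavy w₀ A j hw₀ ho hao hbo hqo fABo _ hUo
  rw [xa, xb, xab] at dX
  rw [ya, yb, yab] at dY
  -- the decomposition of the four championship masses
  have dca := real_twoPair_decomp w o a b heab
    ({ω | (A.filter fun r => ω ∈ openConn a r).card ≤ j} ∩ {ω | j < (A.filter fun r => ω ∈ openConn q r).card})
  have dCa := real_twoPair_decomp w o a b heab
    ({ω | j < (A.filter fun r => ω ∈ openConn a r).card} ∩ {ω | (A.filter fun r => ω ∈ openConn q r).card ≤ j})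
  have dcb := real_twoPair_decomp w o a b heab
    ({ω | (A.filter fun r => ω ∈ openConn b r).card ≤ j} ∩ {ω | j < (A.filter fun r => ω ∈ openConn q r).card})
  have dCb := real_twoPair_decomp w o a b heab
    ({ω | j < (A.filter fun r => ω ∈ openConn b r).card} ∩ {ω | (A.filter fun r => ω ∈ openConn q r).card ≤ j})
  rw [real_preimage_one_counts w₀ A hw₀ ho hao hqo (fun c => c ≤ j) (fun c => j < c),
    real_preimage_one_counts w₀ A hw₀ ho hao hqo (fun c => c ≤ j) (fun c => j < c)] at dca
  rw [real_preimage_one_counts w₀ A hw₀ ho hao hqo (fun c => j < c) (fun c => c ≤ j),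
    real_preimage_one_counts w₀ A hw₀ ho hao hqo (fun c => j < c) (fun c => c ≤ j)] at dCa
  rw [real_preimage_one_counts w₀ A hw₀ ho hbo hqo (fun c => c ≤ j) (fun c => j < c),
    real_preimage_one_counts w₀ A hw₀ ho hbo hqo (fun c => c ≤ j) (fun c => j < c)] at dcb
  rw [real_preimage_one_counts w₀ A hw₀ ho hbo hqo (fun c => j < c) (fun c => c ≤ j),
    real_preimage_one_counts w₀ A hw₀ ho hbo hqo (fun c => j < c) (fun c => c ≤ j)] at dCb
  have ca2 := real_preimage_two_light w₀ A j hw₀ ho hao hbo hqo fABa univ hUuniv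
  have Ca2 := real_preimage_two_heavy w₀ A j hw₀ ho hao hbo hqo fABa univ hUuniv
  have cb2 := real_preimage_two_light w₀ A j hw₀ ho hao hbo hqo fABb univ hUuniv
  have Cb2 := real_preimage_two_heavy w₀ A j hw₀ ho hao hbo hqo fABb univ hUuniv
  simp only [univ_inter] at ca2 Ca2 cb2 Cb2
  rw [ca2] at dca
  rw [Ca2] at dCa
  rw [cb2] at dcb
  rw [Cb2] at dCb
  -- championship as `cc ≤ CC`
  have champ : ∀ x : Fin n,
      (prodBernoulli w).real {ω : BondConfig (Fin n) | (A.filter fun r => ω ∈ openConn x r).card ≤ j} ≤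
        (prodBernoulli w).real {ω : BondConfig (Fin n) | (A.filter fun r => ω ∈ openConn q r).card ≤ j} →
      (prodBernoulli w).real ({ω : BondConfig (Fin n) | (A.filter fun r => ω ∈ openConn x r).card ≤ j} ∩
          {ω | j < (A.filter fun r => ω ∈ openConn q r).card}) ≤
        (prodBernoulli w).real ({ω : BondConfig (Fin n) | j < (A.filter fun r => ω ∈ openConn x r).card} ∩
          {ω | (A.filter fun r => ω ∈ openConn q r).card ≤ j}) := by
    intro x hS
    have e1 : (prodBernoulli w).real {ω : BondConfig (Fin n) | (A.filter fun r => ω ∈ openConn x r).card ≤ j} =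
        (prodBernoulli w).real ({ω : BondConfig (Fin n) | (A.filter fun r => ω ∈ openConn x r).card ≤ j} ∩
          {ω | j < (A.filter fun r => ω ∈ openConn q r).card}) +
        (prodBernoulli w).real ({ω : BondConfig (Fin n) | (A.filter fun r => ω ∈ openConn x r).card ≤ j} \
          {ω | j < (A.filter fun r => ω ∈ openConn q r).card}) :=
      (measureReal_inter_add_sdiff (μ := prodBernoulli w)
        (s := {ω : BondConfig (Fin n) | (A.filter fun r => ω ∈ openConn x r).card ≤ j})
        (t := {ω | j < (A.filter fun r => ω ∈ openConn q r).card}) (hmeas _)).symm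
    have e2 : (prodBernoulli w).real {ω : BondConfig (Fin n) | (A.filter fun r => ω ∈ openConn q r).card ≤ j} =
        (prodBernoulli w).real ({ω : BondConfig (Fin n) | (A.filter fun r => ω ∈ openConn q r).card ≤ j} ∩
          {ω | j < (A.filter fun r => ω ∈ openConn x r).card}) +
        (prodBernoulli w).real ({ω : BondConfig (Fin n) | (A.filter fun r => ω ∈ openConn q r).card ≤ j} \
          {ω | j < (A.filter fun r => ω ∈ openConn x r).card}) :=
      (measureReal_inter_add_sdiff (μ := prodBernoulli w)
        (s := {ω : BondConfig (Fin n) | (A.filter fun r => ω ∈ openConn q r).card ≤ j})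
        (t := {ω | j < (A.filter fun r => ω ∈ openConn x r).card}) (hmeas _)).symm
    have e3 : ({ω : BondConfig (Fin n) | (A.filter fun r => ω ∈ openConn x r).card ≤ j} \
          {ω | j < (A.filter fun r => ω ∈ openConn q r).card}) =
        ({ω : BondConfig (Fin n) | (A.filter fun r => ω ∈ openConn q r).card ≤ j} \
          {ω | j < (A.filter fun r => ω ∈ openConn x r).card}) := by
      ext ω; simp only [mem_sdiff, mem_setOf_eq, not_lt]; tauto
    have e4 : ({ω : BondConfig (Fin n) | (A.filter fun r => ω ∈ openConn q r).card ≤ j} ∩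
          {ω | j < (A.filter fun r => ω ∈ openConn x r).card}) =
        ({ω : BondConfig (Fin n) | j < (A.filter fun r => ω ∈ openConn x r).card} ∩
          {ω | (A.filter fun r => ω ∈ openConn q r).card ≤ j}) := inter_comm _ _
    rw [e3] at e1
    rw [e4] at e2
    linarith
  have hA := champ a hSa
  have hB := champ b hSb
  rw [dca, dCa] at hA
  rw [dcb, dCb] at hB
  -- the glued-pair bound under `w₀`
  have gA := ThreeRelaySliding.gluedPair_exchange_le w₀ A a b q j
  -- assemble
  rw [dX, dY]
  have hα0 : 0 ≤ ((w s(o, a) : ℝ)) := (w s(o, a)).2.1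
  have hα1 : ((w s(o, a) : ℝ)) ≤ 1 := (w s(o, a)).2.2
  have hβ0 : 0 ≤ ((w s(o, b) : ℝ)) := (w s(o, b)).2.1
  have hβ1 : ((w s(o, b) : ℝ)) ≤ 1 := (w s(o, b)).2.2
  have hA' : (1 - (w s(o, a) : ℝ) * (w s(o, b) : ℝ)) *
        (prodBernoulli w₀).real ({ω : BondConfig (Fin n) | (A.filter fun r => ω ∈ openConn a r).card ≤ j} ∩
          {ω | j < (A.filter fun r => ω ∈ openConn q r).card}) +
      (w s(o, a) : ℝ) * (w s(o, b) : ℝ) *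
        (prodBernoulli w₀).real (((openConn a q : Set (BondConfig (Fin n)))ᶜ ∩ (openConn b q : Set (BondConfig (Fin n)))ᶜ) ∩
          ({ω | (A.filter fun r => ω ∈ openConn a r ∨ ω ∈ openConn b r).card ≤ j} ∩
            {ω | j < (A.filter fun r => ω ∈ openConn q r).card})) ≤
      (1 - (w s(o, a) : ℝ) * (w s(o, b) : ℝ)) *
        (prodBernoulli w₀).real ({ω : BondConfig (Fin n) | j < (A.filter fun r => ω ∈ openConn a r).card} ∩
          {ω | (A.filter fun r => ω ∈ openConn q r).card ≤ j}) +
      (w s(o, a) : ℝ) * (w s(o, b) : ℝ) *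
        (prodBernoulli w₀).real (((openConn a q : Set (BondConfig (Fin n)))ᶜ ∩ (openConn b q : Set (BondConfig (Fin n)))ᶜ) ∩
          ({ω | j < (A.filter fun r => ω ∈ openConn a r ∨ ω ∈ openConn b r).card} ∩
            {ω | (A.filter fun r => ω ∈ openConn q r).card ≤ j})) := by
    linarith [hA]
  have hB' : (1 - (w s(o, a) : ℝ) * (w s(o, b) : ℝ)) *
        (prodBernoulli w₀).real ({ω : BondConfig (Fin n) | (A.filter fun r => ω ∈ openConn b r).card ≤ j} ∩
          {ω | j < (A.filter fun r => ω ∈ openConn q r).card}) +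
      (w s(o, a) : ℝ) * (w s(o, b) : ℝ) *
        (prodBernoulli w₀).real (((openConn a q : Set (BondConfig (Fin n)))ᶜ ∩ (openConn b q : Set (BondConfig (Fin n)))ᶜ) ∩
          ({ω | (A.filter fun r => ω ∈ openConn a r ∨ ω ∈ openConn b r).card ≤ j} ∩
            {ω | j < (A.filter fun r => ω ∈ openConn q r).card})) ≤
      (1 - (w s(o, a) : ℝ) * (w s(o, b) : ℝ)) *
        (prodBernoulli w₀).real ({ω : BondConfig (Fin n) | j < (A.filter fun r => ω ∈ openConn b r).card} ∩
          {ω | (A.filter fun r => ω ∈ openConn q r).card ≤ j}) +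
      (w s(o, a) : ℝ) * (w s(o, b) : ℝ) *
        (prodBernoulli w₀).real (((openConn a q : Set (BondConfig (Fin n)))ᶜ ∩ (openConn b q : Set (BondConfig (Fin n)))ᶜ) ∩
          ({ω | j < (A.filter fun r => ω ∈ openConn a r ∨ ω ∈ openConn b r).card} ∩
            {ω | (A.filter fun r => ω ∈ openConn q r).card ≤ j})) := by
    linarith [hB]
  have key := twoPort_algebra hα0 hα1 hβ0 hβ1 measureReal_nonneg measureReal_nonneg hA' hB' gA
  linarith [key]

/-- **REX(2) for a two-port observer, in the shape of `noHeavyLowerTail_of_rex`'s hypothesis** (`Q = {a, b}`): the light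
side may be restricted to attached observers, `{1 ≤ N ≤ j}`. [this work] -/
theorem twoPort_rex_attached (w : Sym2 (Fin n) → unitInterval) (A : Finset (Fin n)) (o a b q : Fin n) (j : ℕ)
    (ho : o ∉ A) (hao : a ≠ o) (hbo : b ≠ o) (hqo : q ≠ o) (hab : a ≠ b)
    (hport : ∀ v, v ≠ o → v ≠ a → v ≠ b → w s(o, v) = 0)
    (hSa : (prodBernoulli w).real {ω : BondConfig (Fin n) | (A.filter fun r => ω ∈ openConn a r).card ≤ j} ≤
      (prodBernoulli w).real {ω : BondConfig (Fin n) | (A.filter fun r => ω ∈ openConn q r).card ≤ j})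
    (hSb : (prodBernoulli w).real {ω : BondConfig (Fin n) | (A.filter fun r => ω ∈ openConn b r).card ≤ j} ≤
      (prodBernoulli w).real {ω : BondConfig (Fin n) | (A.filter fun r => ω ∈ openConn q r).card ≤ j}) :
    (prodBernoulli w).real ((((openConn o a : Set (BondConfig (Fin n))) ∪ (openConn o b : Set (BondConfig (Fin n)))) ∩
        {ω | 1 ≤ (A.filter fun r => ω ∈ openConn o r).card ∧ (A.filter fun r => ω ∈ openConn o r).card ≤ j}) ∩
          {ω | j < (A.filter fun r => ω ∈ openConn q r).card}) ≤
      (prodBernoulli w).real ((((openConn o a : Set (BondConfig (Fin n))) ∪ (openConn o b : Set (BondConfig (Fin n)))) ∩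
        {ω | j < (A.filter fun r => ω ∈ openConn o r).card}) ∩ {ω | (A.filter fun r => ω ∈ openConn q r).card ≤ j}) := by
  refine le_trans (measureReal_mono ?_ (measure_ne_top _ _)) (twoPort_rex w A o a b q j ho hao hbo hqo hab hport hSa hSb)
  rintro ω ⟨⟨hU, -, hl⟩, hh⟩
  exact ⟨⟨hU, hl⟩, hh⟩

end TwoPortExchange

end Summit.CriticalPhenomena.PercolationContinuityZ3.Theorems

end
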